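import Summits.BirchSwinnertonDyer.BirchSwinnertonDyer.Theorems.ByReductionTypeAtTwoSupersingularFlatBlindTwistedInfRes
import Summits.BirchSwinnertonDyer.BirchSwinnertonDyer.Theorems.ByReductionTypeAtTwoMultTransportTwistedDescentResOntoInvariants
import Summits.BirchSwinnertonDyer.BirchSwinnertonDyer.Theorems.ByReductionTypeAtTwoMultTransportTwistedDescentSingle
import Literature.NumberTheory.EllipticCurves.GreenbergSelmerDualDataExistsProofs
import Literature.NumberTheory.GaloisRepresentations.PPrimaryDevissage
import HarnessLib

/-!
# Route `ByReductionTypeAtTwo` (rung K4), crux `SupersingularRankZeroAtTwo` (item stmt-BirchSwinnertonDyer-19097), line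
# `odd_blind_package` v2.6.1 slot 5 (CDF_glob `OddBlindPackage.FlatBlindControlOfLocalAtTwo`), hand h2 = HT-3 (the LIFT), part 1 of 2:
# **ONTO-NESS OF THE TWISTED INFLATION–RESTRICTION** — every `u·conj_γ`-invariant `p^J`-torsion class of `H¹(K_∞, E[p^∞])` is the
# restriction of a class of `H¹(Γ_K, E[p^J](χ_u))`, when `E(K_∞)[p^∞] = 0`
# (cell `bsd-2adic`, seat `t42` GEN 38; LEAD ss-1 GEN 19 `HOME/ss/gen19/HAND-TARGETS-CDFglob.md` §2 h2, pen SUMMON 20260831T042325Z,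
# director-bsd (748))

HONEST FRAMING: THEOREMS ONLY (no definition, no named fact, no `sorry`, no instance); generic Galois-cohomological plumbing (any
number field `K : Type`, any prime `p`, any `ℤ_p`-extension `κ` with a topological generator `γ`, any unit twist `χ_u`, `p ∣ u − 1`);
the converse (onto-) direction of BRICK 1 (`Theorems/ByReductionTypeAtTwoSupersingularFlatBlindTwistedInfRes.lean`); a helper
(`--supports stmt-BirchSwinnertonDyer-19097`): it does NOT prove CDF_glob, CDF±, CDC or the crux; nothing booked; BSD is proved for no
curve by any of this. bears_on: K4 (19097). Part 2 (`…FlatBlindTwistedLift.lean`) adds the local conditions and the count (HT-3 itself).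

## What is proved

* `exists_pushH1_eq_of_pow_smul_eq_zero`, `pushH1_pow_injective` — `H¹(K_∞, E[p^J]) ≅ H¹(K_∞, E[p^∞])[p^J]` (onto: `E[p^∞]` is
  `p^J`-divisible; into: `E(K_∞)[p^∞] = 0`), via the tree's `SignedTransportAtTwo.mem_range_pushH1_of_nsmul_eq_zero` /
  `pushH1_injective_of_saturated`;
* `pow_twistExponent_zsmul_conjH1_eq_self` — if `u · conj_γ y = y` for `y ∈ H¹(K_∞, E[p^J])` then `χ_u(σ) · conj_σ y = y` for EVERY
  `σ ∈ Γ_K` (`χ_u(σ) = u^{κ σ mod p^J}`): `σ = γ^n τ h` with `h ∈ Gal(K̄/K_∞)`, `τ` in an open normal subgroup fixing `y` inside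
  `Gal(K̄/K_J)` (`MultTransportTwistedDescent.exists_eq_pow_mul_mul_of_isTopGenerator`, `GreenbergSelmer.exists_openNormalSubgroup_conjH1_eq`)
  — continuity of the `Γ`-action on the discrete module `H¹(K_∞, E[p^J])`;
* ★ `exists_twistedTorsionToH1_eq_of_zsmul_conjH1_eq` — ONTO-NESS: with `E(K_∞)[p^∞] = 0`, every `s ∈ H¹(K_∞, E[p^∞])` with
  `p^J s = 0`, `u · conj_γ s = s` is `twistedTorsionToH1 x`, `x ∈ H¹(Γ_K, E[p^J](χ_u))`: the class read in the twisted module is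
  invariant under the conjugation action of `Γ_K`, and `H²(Γ_K/Gal(K̄/K_∞), E[p^J](χ_u)^{Gal(K̄/K_∞)}) = H²(·, 0) = 0`, so the element
  form of Hochschild–Serre (T-42 XXXIII `MultTransportTwistedDescent.exists_resSubgroup_eq_of_forall_conjMap_eq_of_subsingleton_two`)
  restricts it from `Γ_K` — Greenberg, LNM 1716 p. 124: «`H¹(F_Σ/F, A_s) → H¹(F_Σ/F_∞, A_s)^Γ` is surjective», with
  «`H¹(F_∞, A_s) = H¹(F_∞, E[p^∞]) ⊗ κ^s`» (p. 107).

References: [GreenbergLNM1716] §4 pp. 107, 122–124; [SerreGaloisCohomology1997] I §2.2, I §2.6 (b); [Washington1997] §13.1–§13.2;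
[GreenbergVatsal2000] p. 3.
-/

set_option autoImplicit false
set_option linter.dupNamespace false

noncomputable section

open scoped Classical NumberField AddSubgroup

namespace Summit.BirchSwinnertonDyer.BirchSwinnertonDyer.Theorems

namespace OddBlindTwist

open NumberField IsDedekindDomain Field WeierstrassCurve Literature.NumberTheory.EllipticCurves
  Literature.NumberTheory.EllipticCurves.IwasawaDual Literature.NumberTheory.GaloisRepresentations
  Literature.NumberTheory.GaloisCohomology ZpExtension Literature.NumberTheory.EllipticCurves.Kobayashi2003
  Literature.NumberTheory.EllipticCurves.Sprung2017 Literature.NumberTheory.EllipticCurves.Sprung2012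
  Literature.NumberTheory.EllipticCurves.Rank1Residual CategoryTheory ContinuousCohomology
open Literature.NumberTheory.GaloisRepresentations.DiscreteGaloisModule (unramifiedSubgroup SelmerStructure)

/-! ## §1 Onto-ness of the twisted inflation–restriction (any number field, any `p`, any unit twist) -/

section Onto

variable {K : Type} [Field K] [NumberField K] (W : WeierstrassCurve K) [W.IsElliptic] (p : ℕ) [Fact p.Prime]
  (κ : ZpExtension K p) (J : ℕ) (u : ℤ) (hu : (p : ℤ) ∣ u - 1)

omit [NumberField K] in
/-- `E[p^∞]` is `p^k`-divisible for every `k` (iterate `SignedTransportAtTwo.exists_nsmul_eq_geomPrimaryTorsion`).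
[cite: SilvermanAEC2009, III.§7] -/
theorem exists_pow_nsmul_eq_geomPrimaryTorsion (k : ℕ) (m : W.geomPrimaryTorsion p) :
    ∃ m' : W.geomPrimaryTorsion p, p ^ k • m' = m := by
  induction k generalizing m with
  | zero => exact ⟨m, by rw [pow_zero, one_smul]⟩
  | succ n ih =>
    obtain ⟨m₁, hm₁⟩ := SignedTransportAtTwo.exists_nsmul_eq_geomPrimaryTorsion W p m
    obtain ⟨m₂, hm₂⟩ := ih m₁
    exact ⟨m₂, by rw [pow_succ', mul_nsmul', hm₂, hm₁]⟩

omit [NumberField K] in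
/-- **Every `p^J`-torsion class of `H¹(K_∞, E[p^∞])` comes from `H¹(K_∞, E[p^J])`** (`E[p^∞]` is `p^J`-divisible and
`E[p^∞][p^J] = E[p^J]`; `SignedTransportAtTwo.mem_range_pushH1_of_nsmul_eq_zero`). [cite: SerreGaloisCohomology1997, I §2.2] -/
theorem exists_pushH1_eq_of_pow_smul_eq_zero (s : W.subgroupH1 p κ.kerSubgroup) (hs : p ^ J • s = 0) :
    ∃ s' : subgroupH1 κ.kerSubgroup (W.geomTorsion ((p ^ J : ℕ) : ℤ)),
      resH1Hom (ContinuousMonoidHom.id κ.kerSubgroup)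
        (AddSubgroup.inclusion (Literature.Barriers.BirchSwinnertonDyer.geomTorsion_pow_le_geomPrimaryTorsion W p J))
        (fun _ _ ↦ rfl) s' = s := by
  have h := SignedTransportAtTwo.mem_range_pushH1_of_nsmul_eq_zero (G := κ.kerSubgroup)
    (AddSubgroup.inclusion (Literature.Barriers.BirchSwinnertonDyer.geomTorsion_pow_le_geomPrimaryTorsion W p J))
    (fun _ _ ↦ rfl) (AddSubgroup.inclusion_injective _) (p := p ^ J) (fun m hm ↦ ?_)
    (exists_pow_nsmul_eq_geomPrimaryTorsion W p J)
    (SignedTransportAtTwo.continuous_subgroup_smul_geomPrimaryTorsion W p κ.kerSubgroup) hs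
  · obtain ⟨s', hs'⟩ := h
    exact ⟨s', hs'⟩
  · -- `E[p^∞][p^J] ⊆ E[p^J]`
    have hm' : ((p ^ J : ℕ) : ℤ) • (m : W.geomPoints) = 0 := by
      rw [natCast_zsmul, ← AddSubgroupClass.coe_nsmul, hm, ZeroMemClass.coe_zero]
    exact ⟨⟨(m : W.geomPoints), (W.mem_geomTorsion_iff _ _).2 hm'⟩, Subtype.ext rfl⟩

omit [NumberField K] [W.IsElliptic] in
/-- **`H¹(K_∞, E[p^J]) → H¹(K_∞, E[p^∞])` is injective when `E(K_∞)[p^∞] = 0`**: a point `m` all of whose `h • m − m`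
(`h ∈ Gal(K̄/K_∞)`) lie in `E[p^J]` has `p^J m ∈ E[p^∞]^{Gal(K̄/K_∞)} = 0` (`SignedTransportAtTwo.pushH1_injective_of_saturated`).
[cite: GreenbergVatsal2000, p. 3 (proof of Thm. (1.4))] [cite: SerreGaloisCohomology1997, I §2.2] -/
theorem pushH1_pow_injective (hfix : FixedPoints.addSubgroup κ.kerSubgroup (W.geomPrimaryTorsion p) = ⊥) :
    Function.Injective (resH1Hom (ContinuousMonoidHom.id κ.kerSubgroup)
      (AddSubgroup.inclusion (Literature.Barriers.BirchSwinnertonDyer.geomTorsion_pow_le_geomPrimaryTorsion W p J))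
      (fun _ _ ↦ rfl)) := by
  refine SignedTransportAtTwo.pushH1_injective_of_saturated _ _ (AddSubgroup.inclusion_injective _) fun m hm ↦ ?_
  have hpm : p ^ J • m ∈ FixedPoints.addSubgroup κ.kerSubgroup (W.geomPrimaryTorsion p) := by
    rw [FixedPoints.mem_addSubgroup]
    intro h
    obtain ⟨x, hx⟩ := hm h
    have hx0 : p ^ J • (h • m - m) = 0 := by
      rw [← hx, ← map_nsmul, W.pow_nsmul_geomTorsion_pow p J x, map_zero]
    rw [smul_sub, sub_eq_zero, smul_comm] at hx0
    exact hx0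
  rw [hfix, AddSubgroup.mem_bot] at hpm
  have hm' : ((p ^ J : ℕ) : ℤ) • (m : W.geomPoints) = 0 := by
    rw [natCast_zsmul, ← AddSubgroupClass.coe_nsmul, hpm, ZeroMemClass.coe_zero]
  exact ⟨⟨(m : W.geomPoints), (W.mem_geomTorsion_iff _ _).2 hm'⟩, Subtype.ext rfl⟩

omit [NumberField K] [W.IsElliptic] in
/-- Every class of `H¹(K_∞, E[p^J])` is killed by `p^J`. [folklore] -/
theorem pow_smul_subgroupH1_geomTorsion_eq_zero (y : subgroupH1 κ.kerSubgroup (W.geomTorsion ((p ^ J : ℕ) : ℤ))) :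
    p ^ J • y = 0 :=
  SignedTransportAtTwo.nsmul_discreteH1_eq_zero_of_forall (fun x ↦ W.pow_nsmul_geomTorsion_pow p J x) y

omit [NumberField K] in
/-- `κ(γ^n) mod p^J` is `n mod p^J` for a topological generator `γ` (`κ γ = 1`). [cite: Washington1997, §13.1–§13.2] -/
theorem twistExponent_pow_of_isTopGenerator {γ : absoluteGaloisGroup K} (hγ : κ.IsTopGenerator γ) (n : ℕ) :
    κ.twistExponent J (γ ^ n) = n % p ^ J := by
  unfold ZpExtension.twistExponent
  rw [map_pow, show κ γ = Multiplicative.ofAdd 1 from hγ, ← ofAdd_nsmul, toAdd_ofAdd, nsmul_eq_mul, mul_one,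
    map_natCast, ZMod.val_natCast]

omit [NumberField K] [W.IsElliptic] in
include hu in
/-- The action of `u^a` on the `p^J`-torsion group `H¹(K_∞, E[p^J])` only depends on `a mod p^J`. [cite: Washington1997, §13.1–§13.2] -/
theorem pow_zsmul_subgroupH1_eq_of_mod_eq {a b : ℕ} (hab : a % p ^ J = b % p ^ J)
    (y : subgroupH1 κ.kerSubgroup (W.geomTorsion ((p ^ J : ℕ) : ℤ))) : (u ^ a) • y = (u ^ b) • y := by
  rw [← ZpExtension.pow_mod_zsmul_eq (pow_smul_subgroupH1_geomTorsion_eq_zero W p κ J) hu a y, hab,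
    ZpExtension.pow_mod_zsmul_eq (pow_smul_subgroupH1_geomTorsion_eq_zero W p κ J) hu b y]

omit [W.IsElliptic] in
/-- **The `χ_u(σ)·conj_σ`-invariance for EVERY `σ ∈ Γ_K`.** If a class `y ∈ H¹(K_∞, E[p^J])` satisfies
`u · conj_γ y = y` for a topological generator `γ`, then `u^{κ(σ) mod p^J} · conj_σ y = y` for every `σ ∈ Γ_K`: write
`σ = γ^n τ h` with `h ∈ Gal(K̄/K_∞)` (acting trivially, `conjH1_of_mem_holds`) and `τ` in an open normal subgroup fixing `y`
(`GreenbergSelmer.exists_openNormalSubgroup_conjH1_eq`) inside `Gal(K̄/K_J)` (so `κ τ ≡ 0`), by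
`MultTransportTwistedDescent.exists_eq_pow_mul_mul_of_isTopGenerator`; then `κ σ ≡ n (mod p^J)` and
`u^n · conj_{γ^n} y = y` by induction. (Continuity of the `Γ`-action on the discrete module `H¹(K_∞, E[p^J])`.)
[cite: GreenbergLNM1716, §4 pp. 107, 124] [cite: Washington1997, §13.1] -/
theorem pow_twistExponent_zsmul_conjH1_eq_self (hu : (p : ℤ) ∣ u - 1) {γ : absoluteGaloisGroup K} (hγ : κ.IsTopGenerator γ)
    (y : subgroupH1 κ.kerSubgroup (W.geomTorsion ((p ^ J : ℕ) : ℤ)))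
    (hy : u • conjH1 κ.kerSubgroup (W.geomTorsion ((p ^ J : ℕ) : ℤ)) γ y = y) (σ : absoluteGaloisGroup K) :
    (u ^ κ.twistExponent J σ) • conjH1 κ.kerSubgroup (W.geomTorsion ((p ^ J : ℕ) : ℤ)) σ y = y := by
  set T := W.geomTorsion ((p ^ J : ℕ) : ℤ) with hT
  have hmul : ∀ (a b : absoluteGaloisGroup K) (z : subgroupH1 κ.kerSubgroup T),
      conjH1 κ.kerSubgroup T (a * b) z = conjH1 κ.kerSubgroup T a (conjH1 κ.kerSubgroup T b z) := fun a b z ↦ by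
    rw [conjH1_mul_holds κ.kerSubgroup T a b, AddMonoidHom.comp_apply]
  -- `u^n · conj_{γ^n} y = y`
  have hpow : ∀ n : ℕ, (u ^ n) • conjH1 κ.kerSubgroup T (γ ^ n) y = y := by
    intro n
    induction n with
    | zero =>
      rw [pow_zero, pow_zero, one_zsmul, show conjH1 κ.kerSubgroup T 1 = AddMonoidHom.id _ from
        conjH1_one_holds κ.kerSubgroup T, AddMonoidHom.id_apply]
    | succ n ih =>
      have e : u • conjH1 κ.kerSubgroup T (γ ^ n) (conjH1 κ.kerSubgroup T γ y) =
          conjH1 κ.kerSubgroup T (γ ^ n) (u • conjH1 κ.kerSubgroup T γ y) := (map_zsmul _ _ _).symm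
      rw [pow_succ, pow_succ, hmul, ← smul_smul, e, hy, ih]
  -- an open normal subgroup fixing `y`, inside `Gal(K̄/K_J)`
  obtain ⟨Nrm₀, hNrm₀⟩ := GreenbergSelmer.exists_openNormalSubgroup_conjH1_eq κ T
    (fun m ↦ W.isOpen_stabilizer_geomTorsion _ m) y
  -- the `J`-th layer subgroup `κ⁻¹(p^J ℤ_p) = Gal(K̄/K_J)` as an open normal subgroup
  let NJ : OpenNormalSubgroup (absoluteGaloisGroup K) :=
    { toSubgroup := κ.layerSubgroup J, isOpen' := κ.isOpen_layerSubgroup J }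
  obtain ⟨n, τ, h, hτ, hh, rfl⟩ := MultTransportTwistedDescent.exists_eq_pow_mul_mul_of_isTopGenerator κ hγ (Nrm₀ ⊓ NJ) σ
  have hτ' : τ ∈ Nrm₀.toOpenSubgroup ⊓ NJ.toOpenSubgroup := hτ
  rw [OpenSubgroup.mem_inf] at hτ'
  have hτ₁ : τ ∈ Nrm₀ := hτ'.1
  have hτ₂ : τ ∈ κ.layerSubgroup J := hτ'.2
  -- `conj_{γ^n τ h} y = conj_{γ^n} y`
  have hconj : conjH1 κ.kerSubgroup T (γ ^ n * τ * h) y = conjH1 κ.kerSubgroup T (γ ^ n) y := by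
    rw [hmul, hmul, show conjH1 κ.kerSubgroup T h = AddMonoidHom.id _ from
      conjH1_of_mem_holds κ.kerSubgroup T hh, AddMonoidHom.id_apply, hNrm₀ τ hτ₁]
  -- `κ(γ^n τ h) ≡ n (mod p^J)`
  have hexp : κ.twistExponent J (γ ^ n * τ * h) % p ^ J = n % p ^ J := by
    rw [ZpExtension.twistExponent_mul, ZpExtension.twistExponent_eq_zero_of_mem_kerSubgroup κ hh, add_zero,
      ZpExtension.twistExponent_mul, ZpExtension.twistExponent_eq_zero_of_mem_layerSubgroup κ hτ₂, add_zero,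
      twistExponent_pow_of_isTopGenerator (p := p) (κ := κ) (J := J) hγ, Nat.mod_mod, Nat.mod_mod, Nat.mod_mod]
  rw [hconj, pow_zsmul_subgroupH1_eq_of_mod_eq (W := W) (p := p) (κ := κ) (J := J) (u := u) hu hexp, hpow n]

/-- **ONTO-NESS of the twisted inflation–restriction.** Let `E(K_∞)[p^∞] = 0` (no `Gal(K̄/K_∞)`-fixed point of `E[p^∞]`),
`γ` a topological generator of `κ`, and `s ∈ H¹(K_∞, E[p^∞])` with `p^J · s = 0` and `u · conj_γ s = s`. Then `s` is the
twisted restriction `twistedTorsionToH1 x` of a class `x ∈ H¹(Γ_K, E[p^J](χ_u))`. Proof: `s` comes from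
`s' ∈ H¹(K_∞, E[p^J])` (`exists_pushH1_eq_of_pow_smul_eq_zero`), still with `u · conj_γ s' = s'` (injectivity,
`pushH1_pow_injective`); read in the twisted module `E[p^J](χ_u)` (on which `Gal(K̄/K_∞)` acts through `E[p^J]`), the class
`s'` is invariant under the conjugation action of EVERY `σ ∈ Γ_K` (`pow_twistExponent_zsmul_conjH1_eq_self`: the twisted
conjugation is `χ_u(σ) · conj_σ`), and `H²(Γ_K/Gal(K̄/K_∞), E[p^J](χ_u)^{Gal(K̄/K_∞)}) = H²(·, 0) = 0`, so the element form
of Hochschild–Serre (`MultTransportTwistedDescent.exists_resSubgroup_eq_of_forall_conjMap_eq_of_subsingleton_two`)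
restricts `s'` from `Γ_K`. Greenberg: «`H¹(F_Σ/F, A_s) → H¹(F_Σ/F_∞, A_s)^Γ` is surjective» (p. 124, with
`H¹(F_∞, A_s) = H¹(F_∞, E[p^∞]) ⊗ κ^s`, p. 107). [cite: GreenbergLNM1716, §4 pp. 107, 124]
[cite: SerreGaloisCohomology1997, I §2.6 (b)] -/
theorem exists_twistedTorsionToH1_eq_of_zsmul_conjH1_eq
    (hfix : FixedPoints.addSubgroup κ.kerSubgroup (W.geomPrimaryTorsion p) = ⊥)
    {γ : absoluteGaloisGroup K} (hγ : κ.IsTopGenerator γ) (s : W.subgroupH1 p κ.kerSubgroup)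
    (hsJ : p ^ J • s = 0) (hsγ : u • W.conjH1 p κ.kerSubgroup γ s = s) :
    ∃ x : galoisCohomology (W.twistedTorsionGaloisModule p κ J u hu) 1, W.twistedTorsionToH1 p κ J u hu x = s := by
  -- (a) lift `s` to `s' = [f] ∈ H¹(K_∞, E[p^J])`
  obtain ⟨s', rfl⟩ := exists_pushH1_eq_of_pow_smul_eq_zero W p κ J s hsJ
  obtain ⟨f, rfl⟩ := oneCocycleClass_surjective _ s'
  -- (b) `u · conj_γ [f] = [f]`
  have hfγ : u • conjH1 κ.kerSubgroup (W.geomTorsion ((p ^ J : ℕ) : ℤ)) γ (oneCocycleClass _ f) = oneCocycleClass _ f := by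
    apply pushH1_pow_injective W p κ J hfix
    rw [map_zsmul, ← AddMonoidHom.comp_apply, ← IwasawaDual.conjH1_comp_resH1Hom_id κ
      (AddSubgroup.inclusion (Literature.Barriers.BirchSwinnertonDyer.geomTorsion_pow_le_geomPrimaryTorsion W p J))
      (fun _ _ ↦ rfl) (fun _ _ ↦ rfl) γ, AddMonoidHom.comp_apply]
    exact hsγ
  -- the action of `Gal(K̄/K_∞)` on the twisted module is the plain one; that of `g ∈ Γ_K` is `χ_u(g) · g`
  have hρN : ∀ (a : κ.kerSubgroup) (v : W.geomTorsion ((p ^ J : ℕ) : ℤ)),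
      (subgroupRep (W.twistedTorsionGaloisModule p κ J u hu).toTopRep κ.kerSubgroup).ρ a v = a • v := fun a v ↦ by
    change W.twistedTorsionGaloisModule p κ J u hu (a : absoluteGaloisGroup K) v = (a : absoluteGaloisGroup K) • v
    rw [ZpExtension.galoisTwist_apply_of_mem_kerSubgroup _ _ _ _ _ _ a.2, torsionGaloisModule_apply_apply]
  have hρG : ∀ (g : absoluteGaloisGroup K) (v : W.geomTorsion ((p ^ J : ℕ) : ℤ)),
      (W.twistedTorsionGaloisModule p κ J u hu).toTopRep.ρ g v = (u ^ κ.twistExponent J g) • g • v :=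
    fun g v ↦ rfl
  -- (c) the same cocycle for the twisted module restricted to `Gal(K̄/K_∞)`
  let ftw : contOneCocycles (subgroupRep (W.twistedTorsionGaloisModule p κ J u hu).toTopRep κ.kerSubgroup) :=
    ⟨f.1, (mem_contOneCocycles_iff _).2 fun a b ↦ by
      rw [(mem_contOneCocycles_iff _).1 f.2 a b, hρN]
      rfl⟩
  have hftw : ∀ n : κ.kerSubgroup, ftw.1 n = f.1 n := fun _ ↦ rfl
  -- (d) `[ftw]` is invariant under the conjugation action of every `g ∈ Γ_K`
  have hinv : ∀ g : absoluteGaloisGroup K,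
      conjMap (W.twistedTorsionGaloisModule p κ J u hu).toTopRep κ.kerSubgroup g 1 (oneCocycleClass _ ftw) =
        oneCocycleClass _ ftw := by
    intro g
    -- the plain side `χ_u(g) · conj_g [f] = [f]`, read on cocycles
    have hplain := pow_twistExponent_zsmul_conjH1_eq_self W p κ J u hu hγ (oneCocycleClass _ f) hfγ g
    have hc : ∀ (x : κ.kerSubgroup) (m : W.geomTorsion ((p ^ J : ℕ) : ℤ)),
        DistribSMul.toAddMonoidHom _ g (subgroupConj κ.kerSubgroup g x • m) = x • DistribSMul.toAddMonoidHom _ g m :=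
      fun x m ↦ by
        simp only [DistribSMul.toAddMonoidHom_apply, Subgroup.smul_def, subgroupConj_apply_coe, smul_smul, mul_assoc,
          mul_inv_cancel_left]
    have hcg : conjH1 κ.kerSubgroup (W.geomTorsion ((p ^ J : ℕ) : ℤ)) g (oneCocycleClass _ f) =
        oneCocycleClass _ (contOneCocycles.pullback (subgroupConj κ.kerSubgroup g)
          (resHomOfEquivariant (subgroupConj κ.kerSubgroup g) (DistribSMul.toAddMonoidHom _ g) hc) f) :=
      map_oneCocycleClass (discreteTopRep κ.kerSubgroup (W.geomTorsion ((p ^ J : ℕ) : ℤ))) (subgroupConj κ.kerSubgroup g)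
        (resHomOfEquivariant (subgroupConj κ.kerSubgroup g) (DistribSMul.toAddMonoidHom _ g) hc) f
    have hs : oneCocycleClass _ ((u ^ κ.twistExponent J g) • contOneCocycles.pullback (subgroupConj κ.kerSubgroup g)
          (resHomOfEquivariant (subgroupConj κ.kerSubgroup g) (DistribSMul.toAddMonoidHom _ g) hc) f) =
        (u ^ κ.twistExponent J g) • oneCocycleClass _ (contOneCocycles.pullback (subgroupConj κ.kerSubgroup g)
          (resHomOfEquivariant (subgroupConj κ.kerSubgroup g) (DistribSMul.toAddMonoidHom _ g) hc) f) :=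
      map_zsmul (oneCocycleClassₗ (discreteTopRep κ.kerSubgroup (W.geomTorsion ((p ^ J : ℕ) : ℤ)))) _ _
    rw [hcg, ← hs, ← sub_eq_zero, ← oneCocycleClass_sub, oneCocycleClass_eq_zero_iff] at hplain
    obtain ⟨m, hm⟩ := hplain
    rw [conjMap_oneCocycleClass, ← sub_eq_zero, ← oneCocycleClass_sub, oneCocycleClass_eq_zero_iff]
    refine ⟨m, fun n ↦ ?_⟩
    have h1 := hm n
    change (u ^ κ.twistExponent J g) • g • f.1 (subgroupConj κ.kerSubgroup g n) - f.1 n =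
      (n : absoluteGaloisGroup K) • m - m at h1
    change (W.twistedTorsionGaloisModule p κ J u hu).toTopRep.ρ g (ftw.1 (subgroupConj κ.kerSubgroup g n)) - ftw.1 n =
      (subgroupRep (W.twistedTorsionGaloisModule p κ J u hu).toTopRep κ.kerSubgroup).ρ n m - m
    rw [hρN, hftw, hftw, hρG]
    exact h1
  -- (e) Hochschild–Serre, element form: `H²(Γ_K/Gal(K̄/K_∞), E[p^J](χ_u)^{Gal(K̄/K_∞)}) = H²(·, 0) = 0`
  haveI : CompactSpace (absoluteGaloisGroup K) := by
    change CompactSpace (AlgebraicClosure K ≃ₐ[K] AlgebraicClosure K); infer_instance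
  haveI : TotallyDisconnectedSpace (absoluteGaloisGroup K) := by
    change TotallyDisconnectedSpace (AlgebraicClosure K ≃ₐ[K] AlgebraicClosure K); infer_instance
  haveI : IsClosed (κ.kerSubgroup : Set (absoluteGaloisGroup K)) := κ.isClosed_kerSubgroup
  haveI : Subsingleton (ContinuousRep.quotientInvariants κ.kerSubgroup (W.twistedTorsionGaloisModule p κ J u hu)).toTopRep := by
    refine ⟨fun a b ↦ ?_⟩
    have h0 : ∀ c : (ContinuousRep.quotientInvariants κ.kerSubgroup (W.twistedTorsionGaloisModule p κ J u hu)).toTopRep,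
        c = 0 := fun c ↦ by
      have hc : AddSubgroup.inclusion (Literature.Barriers.BirchSwinnertonDyer.geomTorsion_pow_le_geomPrimaryTorsion W p J)
          c.1 ∈ FixedPoints.addSubgroup κ.kerSubgroup (W.geomPrimaryTorsion p) := by
        rw [FixedPoints.mem_addSubgroup]
        intro n
        have h := (ContinuousRep.mem_invariantsOf_iff κ.kerSubgroup (W.twistedTorsionGaloisModule p κ J u hu) c.1).1 c.2 n
        change W.twistedTorsionGaloisModule p κ J u hu (n : absoluteGaloisGroup K) c.1 = c.1 at h
        rw [ZpExtension.galoisTwist_apply_of_mem_kerSubgroup _ _ _ _ _ _ n.2, torsionGaloisModule_apply_apply] at h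
        exact congrArg (AddSubgroup.inclusion
          (Literature.Barriers.BirchSwinnertonDyer.geomTorsion_pow_le_geomPrimaryTorsion W p J)) h
      rw [hfix, AddSubgroup.mem_bot, map_eq_zero_iff _ (AddSubgroup.inclusion_injective _)] at hc
      exact Subtype.ext hc
    rw [h0 a, h0 b]
  haveI : Subsingleton (continuousCohomology 2
      (ContinuousRep.quotientInvariants κ.kerSubgroup (W.twistedTorsionGaloisModule p κ J u hu)).toTopRep) :=
    subsingleton_continuousCohomology_of_subsingleton _ 1
  obtain ⟨xc, hxc⟩ := MultTransportTwistedDescent.exists_resSubgroup_eq_of_forall_conjMap_eq_of_subsingleton_two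
    κ.kerSubgroup (W.twistedTorsionGaloisModule p κ J u hu) (oneCocycleClass _ ftw) hinv
  -- (f) `twistedTorsionToH1 xc = ι_* [f]`
  refine ⟨xc, ?_⟩
  obtain ⟨ξ, rfl⟩ := oneCocycleClass_surjective _ xc
  have key : resSubgroup (W.twistedTorsionGaloisModule p κ J u hu).toTopRep κ.kerSubgroup 1 (oneCocycleClass _ ξ) -
      oneCocycleClass (subgroupRep (W.twistedTorsionGaloisModule p κ J u hu).toTopRep κ.kerSubgroup) ftw = 0 :=
    sub_eq_zero.2 hxc
  rw [resSubgroup_oneCocycleClass, ← oneCocycleClass_sub, oneCocycleClass_eq_zero_iff] at key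
  obtain ⟨m', hm'⟩ := key
  change W.twistedTorsionToH1 p κ J u hu (oneCocycleClass _ ξ) = _
  rw [twistedTorsionToH1_oneCocycleClass, resH1Hom_id_oneCocycleClass, ← sub_eq_zero, ← oneCocycleClass_sub,
    oneCocycleClass_eq_zero_iff]
  refine ⟨AddSubgroup.inclusion (Literature.Barriers.BirchSwinnertonDyer.geomTorsion_pow_le_geomPrimaryTorsion W p J) m',
    fun n ↦ ?_⟩
  have h1 := hm' n
  change ξ.1 (n : absoluteGaloisGroup K) - ftw.1 n =
    (subgroupRep (W.twistedTorsionGaloisModule p κ J u hu).toTopRep κ.kerSubgroup).ρ n m' - m' at h1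
  rw [hftw, hρN] at h1
  change AddSubgroup.inclusion (Literature.Barriers.BirchSwinnertonDyer.geomTorsion_pow_le_geomPrimaryTorsion W p J)
      (ξ.1 (n : absoluteGaloisGroup K)) -
    AddSubgroup.inclusion (Literature.Barriers.BirchSwinnertonDyer.geomTorsion_pow_le_geomPrimaryTorsion W p J) (f.1 n) =
      (n : absoluteGaloisGroup K) •
        AddSubgroup.inclusion (Literature.Barriers.BirchSwinnertonDyer.geomTorsion_pow_le_geomPrimaryTorsion W p J) m' -
      AddSubgroup.inclusion (Literature.Barriers.BirchSwinnertonDyer.geomTorsion_pow_le_geomPrimaryTorsion W p J) m'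
  rw [← map_sub, h1, map_sub]
  rfl

end Onto


end OddBlindTwist

end Summit.BirchSwinnertonDyer.BirchSwinnertonDyer.Theorems

end
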